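import Summits.MatrixMultiplication.OmegaCensus.STPP222PowCyclic
import Mathlib.Combinatorics.Additive.AP.Three.Behrend
import Mathlib.Data.Finset.Sort
import Mathlib.Data.Nat.Digits.Lemmas

/-!
# ω-census, cyclic STPP law `(2,2,2)^k` from 3-AP-free sets of integers: `ℤ/mℤ ⊇ (2,2,2)^k` for every `m ≥ 16n − 8`

HONEST FRAMING (pub-omega census; verbatim): lottery ticket; floor = certified bounds/negative ranges.
Census STRUCTURE bookkeeping (question Q7 of `STRUCTURE.md`: the CYCLIC threshold of `k` simultaneous-TPP triples of
2-subsets), not progress on `ω`: a `(2,2,2)^k` STPP family gives no matrix-multiplication bound of interest.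

THE FAMILY (integers; `f : Fin k → ℕ` injective with 3-AP-free range, Mathlib `ThreeAPFree`):
`Aᵢ = {0, 1}`, `Bᵢ = {16 fᵢ, 16 fᵢ + 2}`, `Cᵢ = {8 fᵢ, 8 fᵢ + 4}`.
Every constraint expression of CKSU Def. 5.1 (tree form `IsSTPP`: `(s'−s)+(t'−t)+(u'−u)` with `s' ∈ Aᵢ, s ∈ A_l, t ∈ Bᵢ,
t' ∈ Bⱼ, u ∈ Cⱼ, u' ∈ C_l`) equals `8·(fⱼ + f_l − 2fᵢ) + ε` with `ε = e₁+e₂+e₃`, `e₁ ∈ {0,±1}`, `e₂ ∈ {0,±2}`, `e₃ ∈ {0,±4}`.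
If it vanishes then `8 ∣ ε`, so `ε = 0`, so all digits vanish and `fⱼ + f_l = 2fᵢ`, a 3-term progression inside the range of
`f`, hence trivial: `fⱼ = fᵢ = f_l` and `i = j = l`.  All expressions have absolute value `≤ 16·max f + 7`, so reducing
modulo any `m ≥ 16·max f + 8` preserves the STPP (a vanishing residue of an integer of absolute value `< m` is a vanishing
integer) — the same integer-lift mechanism as the quadratic uniform family of `STPP222PowCyclic.lean` (`8k(k−1)+8 ≤ m`,
which is the special case `fᵢ = k·i`… replaced here by a Salem–Spencer set).  The idea of seeding a simultaneous product
property with a 3-AP-free set is CKSU 2005's (Lemma 35 there, for the simultaneous DOUBLE product property); the tree's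
non-cyclic version is `STPPThreeAPFree.lean` (`(2,2,2)^{r₃(N)} ⊆ (ℤ/2)³ × ℤ/(2N)`, stpp-2).  New here: CYCLIC hosts and an
up-set in `m`.

* `isSTPP_apFam` / `exists_isSTPP_222pow_zmod_of_threeAPFree` — the reduced family (`Aᵢ = {0,1}`, `Bᵢ = {16fᵢ, 16fᵢ+2}`,
  `Cᵢ = {8fᵢ, 8fᵢ+4}`, written with `pairZ` of `STPP222PowCyclic.lean`) is an STPP family of 2-subsets of `ZMod m`
  whenever `16 fᵢ + 8 ≤ m` for all `i`;
* `exists_isSTPP_222pow_zmod_of_le_rothNumberNat` — **for all `N`, all `k ≤ rothNumberNat N` and all `m ≥ 16N − 8`,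
  `ℤ/mℤ ⊇ (2,2,2)^k`**; so the census's cyclic all-moduli threshold satisfies `M_k ≤ 16·n₃(k) − 8` with `n₃(k)` the least `N`
  having a `k`-element 3-AP-free subset of `{0,…,N−1}` (`n₃ = 2, 4, 5, 9, 11, 13, 14, 20, 24, 26, …`), i.e. `M_k ≤ 24, 56, 72,
  136, 168, 200, 216, 312, 376, 408, …` — below the quadratic law `8k(k−1)+8` for every `k ≥ 4`;
* `exists_isSTPP_222pow_of_exponent_ge` — hence every finite abelian group of exponent `≥ 16N − 8` hosts
  `(2,2,2)^{rothNumberNat N}`;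
* `exists_isSTPP_222pow_zmod_behrend` — with Mathlib's `Behrend.roth_lower_bound`: for every `N` and every `m ≥ 16N − 8` some
  `k ≥ N·e^{−4√(log N)}` triples fit in `ℤ/mℤ` — the CYCLIC finite form of `M_k ≤ k^{1+o(1)}` (the tree's `NR146`
  `STPPCountSublinear.lean` gives the other side `M_k / k → ∞`);
* `exists_isSTPP_2226_zmod_of_le168`, `exists_isSTPP_2227_zmod_of_le200` — the explicit rungs `k = 6` (`{0,1,3,7,8,10} ⊆ [0,11)`)
  and `k = 7` (`{0,1,3,4,9,10,12} ⊆ [0,13)`): every `ℤ/mℤ` with `m ≥ 168` hosts `(2,2,2)⁶`, with `m ≥ 200` hosts `(2,2,2)⁷`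
  (census before: the single cell `ℤ/128 ⊇ (2,2,2)⁶` and the quadratic law `m ≥ 248` / `m ≥ 344`).

No sharpness is claimed anywhere (e.g. `k = 5` gives `m ≥ 136` while the tree has `m ≥ 100`, `STPP222Pow5Cyclic.lean`).

References: H. Cohn, R. Kleinberg, B. Szegedy, C. Umans, FOCS 2005 (arXiv:math/0511460), Def. 5.1 and Lemma 35;
F. Behrend, Proc. Nat. Acad. Sci. 32 (1946) 331–332 (via Mathlib).  Seat pub-omega-stpp-3 (gen 10), 2026-08-24.
-/

open Literature.Computability.AlgebraicComplexity Finset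

namespace Summit.MatrixMultiplication.OmegaCensus

/-! ## Arithmetic core (integers) -/

/-- The size bound: for `FI, FJ, FL ≥ 0` with `16·F + 8 ≤ M` and digits `e₁ ∈ {0,±1}`, `e₂ ∈ {0,±2}`, `e₃ ∈ {0,±4}`, the
expression `e₁ + (16 FJ − 16 FI + e₂) + (8 FL − 8 FJ + e₃)` lies strictly between `−M` and `M`. -/
theorem apFam_expr_bound (FI FJ FL e₁ e₂ e₃ M : ℤ) (hI : 0 ≤ FI) (hJ : 0 ≤ FJ) (hL : 0 ≤ FL)
    (hIM : 16 * FI + 8 ≤ M) (hJM : 16 * FJ + 8 ≤ M) (hLM : 16 * FL + 8 ≤ M)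
    (h1 : e₁ = -1 ∨ e₁ = 0 ∨ e₁ = 1) (h2 : e₂ = -2 ∨ e₂ = 0 ∨ e₂ = 2) (h3 : e₃ = -4 ∨ e₃ = 0 ∨ e₃ = 4) :
    -M < e₁ + (16 * FJ - 16 * FI + e₂) + (8 * FL - 8 * FJ + e₃) ∧
      e₁ + (16 * FJ - 16 * FI + e₂) + (8 * FL - 8 * FJ + e₃) < M := by
  constructor <;> omega

/-- The digit argument: if the expression vanishes then `FJ + FL = FI + FI` (a 3-term progression `FJ, FI, FL`) and all
digits are `0`. -/
theorem apFam_expr_eq_zero (FI FJ FL e₁ e₂ e₃ : ℤ)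
    (h1 : e₁ = -1 ∨ e₁ = 0 ∨ e₁ = 1) (h2 : e₂ = -2 ∨ e₂ = 0 ∨ e₂ = 2) (h3 : e₃ = -4 ∨ e₃ = 0 ∨ e₃ = 4)
    (h : e₁ + (16 * FJ - 16 * FI + e₂) + (8 * FL - 8 * FJ + e₃) = 0) :
    FJ + FL = FI + FI ∧ e₁ = 0 ∧ e₂ = 0 ∧ e₃ = 0 := by
  omega

/-! ## The STPP property and the cardinalities in `ZMod m` -/

/-- **The 3-AP-free family is an STPP family in `ZMod m` whenever `16 fᵢ + 8 ≤ m` for all `i`.** Each difference is lifted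
to an integer (`diff_of_mem_pair`); the vanishing residue is an integer multiple of `m` of absolute value `< m`
(`apFam_expr_bound`), hence the integer expression vanishes, `apFam_expr_eq_zero` yields a 3-term progression
`fⱼ + f_l = 2 fᵢ` in the range of `f`, which `ThreeAPFree` makes trivial, and injectivity of `f` gives `i = j = l`.
[cite: CohnKleinbergSzegedyUmans2005, Def. 5.1] -/
theorem isSTPP_apFam (m k : ℕ) (f : Fin k → ℕ) (hf : Function.Injective f) (hap : ThreeAPFree (Set.range f))
    (hm : ∀ i, 16 * f i + 8 ≤ m) :
    IsSTPP (fun _ : Fin k => pairZ m 0 1) (fun i => pairZ m (16 * ((f i : ℕ) : ℤ)) 2)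
      (fun i => pairZ m (8 * ((f i : ℕ) : ℤ)) 4) := by
  intro i j l s hs s' hs' t ht t' ht' u hu u' hu' heq
  simp only [pairZ, Finset.mem_insert, Finset.mem_singleton] at hs hs' ht ht' hu hu'
  obtain ⟨e₁, he₁, hd₁, hq₁⟩ := diff_of_mem_pair hs hs'
  obtain ⟨e₂, he₂, hd₂, hq₂⟩ := diff_of_mem_pair ht ht'
  obtain ⟨e₃, he₃, hd₃, hq₃⟩ := diff_of_mem_pair hu hu'
  rw [hd₁, hd₂, hd₃] at heq
  have hE : ((e₁ + (16 * ((f j : ℕ) : ℤ) - 16 * ((f i : ℕ) : ℤ) + e₂) +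
      (8 * ((f l : ℕ) : ℤ) - 8 * ((f j : ℕ) : ℤ) + e₃) : ℤ) : ZMod m) = 0 := by
    rw [← heq]; push_cast; ring
  rw [ZMod.intCast_zmod_eq_zero_iff_dvd] at hE
  have hIM : 16 * ((f i : ℕ) : ℤ) + 8 ≤ m := by exact_mod_cast hm i
  have hJM : 16 * ((f j : ℕ) : ℤ) + 8 ≤ m := by exact_mod_cast hm j
  have hLM : 16 * ((f l : ℕ) : ℤ) + 8 ≤ m := by exact_mod_cast hm l
  have hb := apFam_expr_bound (f i) (f j) (f l) e₁ e₂ e₃ m (by positivity) (by positivity) (by positivity)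
    hIM hJM hLM he₁ he₂ he₃
  have hz : e₁ + (16 * ((f j : ℕ) : ℤ) - 16 * ((f i : ℕ) : ℤ) + e₂) +
      (8 * ((f l : ℕ) : ℤ) - 8 * ((f j : ℕ) : ℤ) + e₃) = (0 : ℤ) := by
    apply Int.eq_zero_of_dvd_of_natAbs_lt_natAbs hE
    simp only [Int.natAbs_natCast]
    omega
  obtain ⟨hap', r1, r2, r3⟩ := apFam_expr_eq_zero (f i) (f j) (f l) e₁ e₂ e₃ he₁ he₂ he₃ hz
  have hsum : f j + f l = f i + f i := by exact_mod_cast hap'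
  have hji : f j = f i := hap (Set.mem_range_self j) (Set.mem_range_self i) (Set.mem_range_self l) hsum
  have hli : f l = f i := by omega
  have hij' : i = j := (hf hji).symm
  have hjl' : j = l := hf (hji.trans hli.symm)
  subst hij' hjl'
  exact ⟨rfl, rfl, hq₁ r1 rfl, hq₂ r2 rfl, hq₃ r3 rfl⟩

/-- **For every injective `f : Fin k → ℕ` with 3-AP-free range and every `m` with `16 fᵢ + 8 ≤ m` for all `i`, the cyclic
group `ℤ/mℤ` admits `k` simultaneous-TPP triples of 2-subsets** (the pattern `(2,2,2)^k` of the census).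
[cite: CohnKleinbergSzegedyUmans2005, Def. 5.1] -/
theorem exists_isSTPP_222pow_zmod_of_threeAPFree {k m : ℕ} (f : Fin k → ℕ) (hf : Function.Injective f)
    (hap : ThreeAPFree (Set.range f)) (hm : ∀ i, 16 * f i + 8 ≤ m) :
    ∃ A B C : Fin k → Finset (ZMod m), IsSTPP A B C ∧
      ∀ i, (A i).card = 2 ∧ (B i).card = 2 ∧ (C i).card = 2 := by
  refine ⟨_, _, _, isSTPP_apFam m k f hf hap hm, fun i => ?_⟩
  have hm8 : (8 : ℤ) ≤ m := by have := hm i; omega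
  exact ⟨card_pairZ _ _ (by norm_num) (by omega), card_pairZ _ _ (by norm_num) (by omega),
    card_pairZ _ _ (by norm_num) (by omega)⟩

/-- **`(2,2,2)^k ⊆ ℤ/mℤ` for every `k ≤ rothNumberNat N` and every `m ≥ 16N − 8`** (`rothNumberNat N` = the largest size of a
3-AP-free subset of `{0,…,N−1}`, Mathlib): enumerate a largest 3-AP-free subset increasingly and keep its first `k` values.
Census reading: the all-moduli cyclic threshold satisfies `M_k ≤ 16·n₃(k) − 8`, `n₃(k) = min {N : rothNumberNat N ≥ k}`.
[cite: CohnKleinbergSzegedyUmans2005, Def. 5.1] -/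
theorem exists_isSTPP_222pow_zmod_of_le_rothNumberNat (N k m : ℕ) (hk : k ≤ rothNumberNat N) (hm : 16 * N ≤ m + 8) :
    ∃ A B C : Fin k → Finset (ZMod m), IsSTPP A B C ∧
      ∀ i, (A i).card = 2 ∧ (B i).card = 2 ∧ (C i).card = 2 := by
  obtain ⟨t, ht, hcard, hap⟩ := rothNumberNat_spec N
  -- enumerate `t` increasingly and keep the first `k` values
  let g : Fin t.card → ℕ := fun i => t.orderEmbOfFin rfl i
  have hg : Function.Injective g := (t.orderEmbOfFin rfl).injective
  have hmem : ∀ i, g i ∈ t := fun i => t.orderEmbOfFin_mem rfl i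
  have hkt : k ≤ t.card := hcard ▸ hk
  let f : Fin k → ℕ := fun i => g (Fin.castLE hkt i)
  have hf : Function.Injective f := hg.comp (Fin.castLE_injective hkt)
  have hrange : Set.range f ⊆ (t : Set ℕ) := by rintro _ ⟨i, rfl⟩; exact hmem _
  have hfm : ∀ i, 16 * f i + 8 ≤ m := fun i => by
    have := ht (hmem (Fin.castLE hkt i)); rw [mem_range] at this
    change 16 * g (Fin.castLE hkt i) + 8 ≤ m
    omega
  exact exists_isSTPP_222pow_zmod_of_threeAPFree f hf (hap.mono hrange) hfm

/-- **A finite abelian group of exponent `≥ 16N − 8` admits `(2,2,2)^k` for every `k ≤ rothNumberNat N`** (transport along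
`ℤ/(ord g) ↪ G` for an element `g` of maximal order, as in `STPP222PowCyclic.lean`).
[cite: CohnKleinbergSzegedyUmans2005, Def. 5.1] -/
theorem exists_isSTPP_222pow_of_exponent_ge {G : Type*} [AddCommGroup G] [Finite G] (N k : ℕ)
    (hk : k ≤ rothNumberNat N) (h : 16 * N ≤ AddMonoid.exponent G + 8) :
    ∃ A B C : Fin k → Finset G, IsSTPP A B C ∧ ∀ i, (A i).card = 2 ∧ (B i).card = 2 ∧ (C i).card = 2 := by
  obtain ⟨g, hg⟩ := AddMonoid.exists_addOrderOf_eq_exponent (AddMonoid.ExponentExists.of_finite (G := G))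
  exact exists_isSTPP_222pow_of_injective _ (zmod_lift_zmultiples_injective g)
    (exists_isSTPP_222pow_zmod_of_le_rothNumberNat N k (addOrderOf g) hk (by rw [hg]; exact h))

/-- **Cyclic Behrend form of `M_k ≤ k^{1+o(1)}` (STRUCTURE Q7).** For every `N` and every `m ≥ 16N − 8` there is a `k` with
`N · e^{−4√(log N)} ≤ k` such that `k` simultaneous-TPP triples of 2-subsets exist in `ℤ/mℤ`: `k = rothNumberNat N`
(`exists_isSTPP_222pow_zmod_of_le_rothNumberNat`), bounded below by Mathlib's `Behrend.roth_lower_bound`.  No lower bound on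
the threshold is claimed here (see `STPPCountSublinear.lean` for `M_k / k → ∞`). [cite: CohnKleinbergSzegedyUmans2005, Def. 5.1] -/
theorem exists_isSTPP_222pow_zmod_behrend (N m : ℕ) (hm : 16 * N ≤ m + 8) :
    ∃ k : ℕ, (N : ℝ) * Real.exp (-4 * √(Real.log N)) ≤ k ∧
      ∃ A B C : Fin k → Finset (ZMod m), IsSTPP A B C ∧
        ∀ i, (A i).card = 2 ∧ (B i).card = 2 ∧ (C i).card = 2 :=
  ⟨rothNumberNat N, Behrend.roth_lower_bound, exists_isSTPP_222pow_zmod_of_le_rothNumberNat N _ m le_rfl hm⟩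

/-! ## Explicit rungs `k = 6` and `k = 7` -/

/-- `{0, 1, 3, 7, 8, 10}` has no non-trivial 3-term arithmetic progression (kernel `decide` over the `6³` triples). -/
theorem threeAPFree_apSeed6 : ThreeAPFree (Set.range (![0, 1, 3, 7, 8, 10] : Fin 6 → ℕ)) := by
  rintro _ ⟨a, rfl⟩ _ ⟨b, rfl⟩ _ ⟨c, rfl⟩ h
  revert a b c
  decide

/-- `{0, 1, 3, 4, 9, 10, 12}` has no non-trivial 3-term arithmetic progression (kernel `decide` over the `7³` triples). -/
theorem threeAPFree_apSeed7 : ThreeAPFree (Set.range (![0, 1, 3, 4, 9, 10, 12] : Fin 7 → ℕ)) := by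
  rintro _ ⟨a, rfl⟩ _ ⟨b, rfl⟩ _ ⟨c, rfl⟩ h
  revert a b c
  decide

/-- **Every `ℤ/mℤ` with `m ≥ 168` admits `(2,2,2)⁶`** (six simultaneous-TPP triples of 2-subsets): the 3-AP-free family on
`{0,1,3,7,8,10}`, `16·10 + 8 = 168`.  Census: the `k = 6` cyclic column had the single cell `ℤ/128` and the quadratic law
`m ≥ 248` before. [cite: CohnKleinbergSzegedyUmans2005, Def. 5.1] -/
theorem exists_isSTPP_2226_zmod_of_le168 (m : ℕ) (hm : 168 ≤ m) :
    ∃ A B C : Fin 6 → Finset (ZMod m), IsSTPP A B C ∧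
      ∀ i, (A i).card = 2 ∧ (B i).card = 2 ∧ (C i).card = 2 :=
  exists_isSTPP_222pow_zmod_of_threeAPFree (![0, 1, 3, 7, 8, 10] : Fin 6 → ℕ) (by decide) threeAPFree_apSeed6
    (fun i => by fin_cases i <;> simp <;> omega)

/-- **Every `ℤ/mℤ` with `m ≥ 200` admits `(2,2,2)⁷`**: the 3-AP-free family on `{0,1,3,4,9,10,12}`, `16·12 + 8 = 200`
(quadratic law: `m ≥ 344`). [cite: CohnKleinbergSzegedyUmans2005, Def. 5.1] -/
theorem exists_isSTPP_2227_zmod_of_le200 (m : ℕ) (hm : 200 ≤ m) :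
    ∃ A B C : Fin 7 → Finset (ZMod m), IsSTPP A B C ∧
      ∀ i, (A i).card = 2 ∧ (B i).card = 2 ∧ (C i).card = 2 :=
  exists_isSTPP_222pow_zmod_of_threeAPFree (![0, 1, 3, 4, 9, 10, 12] : Fin 7 → ℕ) (by decide) threeAPFree_apSeed7
    (fun i => by fin_cases i <;> simp <;> omega)

/-- Exponent form of the `k = 6` rung: **every finite abelian group of exponent `≥ 168` hosts `(2,2,2)⁶`.**
[cite: CohnKleinbergSzegedyUmans2005, Def. 5.1] -/
theorem exists_isSTPP_2226_of_exponent_ge168 {G : Type*} [AddCommGroup G] [Finite G]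
    (h : 168 ≤ AddMonoid.exponent G) :
    ∃ A B C : Fin 6 → Finset G, IsSTPP A B C ∧ ∀ i, (A i).card = 2 ∧ (B i).card = 2 ∧ (C i).card = 2 := by
  obtain ⟨g, hg⟩ := AddMonoid.exists_addOrderOf_eq_exponent (AddMonoid.ExponentExists.of_finite (G := G))
  exact exists_isSTPP_222pow_of_injective _ (zmod_lift_zmultiples_injective g)
    (exists_isSTPP_2226_zmod_of_le168 (addOrderOf g) (by rw [hg]; exact h))

/-!
# APPEND (gen 10, same seat): explicit cyclic STPP law: `ℤ/mℤ ⊇ (2,2,2)^k` for all `k ≤ 2^t` and all `m ≥ 8·3^t`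

HONEST FRAMING (pub-omega census; verbatim): lottery ticket; floor = certified bounds/negative ranges.
Census STRUCTURE bookkeeping (question Q7 of `STRUCTURE.md`: the cyclic threshold of `k` simultaneous-TPP triples of 2-subsets),
not progress on `ω`: a `(2,2,2)^k` STPP family gives no matrix-multiplication bound of interest.

The 3-AP-free cyclic law `exists_isSTPP_222pow_zmod_of_threeAPFree` (`STPP222PowCyclicThreeAPFree.lean`) turns an injective
3-AP-free `f : Fin k → ℕ` into `(2,2,2)^k ⊆ ℤ/mℤ` for every `m` with `16 fᵢ + 8 ≤ m`.  Here it is fed the classical Erdős–Turán /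
Salem–Spencer set of natural numbers whose base-3 digits are all `0` or `1`, written WITHOUT new definitions as
`β x = Nat.ofDigits 3 (Nat.digits 2 x)` (read the binary digits of `x` in base `3`; `β x = x % 2 + 3·β (x/2)`):

* `eq_of_ofDigits_three_digits_two_add` — `β a + β c = 2·β b → a = b` (last digits: `a%2 + c%2 ≡ 2(b%2) (mod 3)` forces equal
  bits, then induct) — so `β` is injective with 3-AP-free range on every index set (`Mathlib.ThreeAPFree`);
* `two_mul_ofDigits_three_digits_two_lt` — `x < 2^t → 2·β x + 1 ≤ 3^t`;
* `exists_isSTPP_222pow_zmod_of_le_two_pow` — **for all `t`, all `k ≤ 2^t` and all `m ≥ 8·3^t`, `ℤ/mℤ` admits `k` simultaneous-TPP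
  triples of 2-subsets**; in census terms the all-moduli cyclic threshold obeys the EXPLICIT law
  `M_k ≤ 8·3^{⌈log₂ k⌉} < 24·k^{log₂ 3} ≈ 24·k^{1.585}` for every `k ≥ 1` (`k = 4, 8, 16, 32, 64 ↦ m ≥ 72, 216, 648, 1944, 5832`;
  the quadratic law `8k(k−1)+8` of `STPP222PowCyclic.lean` gives `104, 456, 1928, 7944, 32264`), sitting between that law and the
  non-explicit Behrend form `M_k ≤ k^{1+o(1)}` (`exists_isSTPP_222pow_zmod_behrend`);
* `exists_isSTPP_222pow_of_exponent_ge_two_pow` — the same for every finite abelian group of exponent `≥ 8·3^t`;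
* `exists_isSTPP_222pow64_zmod_of_le5832` — the worked instance `t = 6`.

No sharpness is claimed.  References: H. Cohn, R. Kleinberg, B. Szegedy, C. Umans, FOCS 2005 (arXiv:math/0511460), Def. 5.1 and
Lemma 35 (Salem–Spencer seeding); P. Erdős, P. Turán, J. London Math. Soc. 11 (1936) 261–264 (the base-3 set).
Seat pub-omega-stpp-3 (gen 10), 2026-08-24.
-/



/-! ## The base-3 reading of binary digits (no new definitions) -/

/-- The recursion `β x = x % 2 + 3·β (x/2)` for `β x = Nat.ofDigits 3 (Nat.digits 2 x)` (also at `x = 0`). -/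
theorem ofDigits_three_digits_two (x : ℕ) :
    Nat.ofDigits 3 (Nat.digits 2 x) = x % 2 + 3 * Nat.ofDigits 3 (Nat.digits 2 (x / 2)) := by
  rcases Nat.eq_zero_or_pos x with rfl | hx
  · simp
  · rw [Nat.digits_def' (by norm_num) hx, Nat.ofDigits_cons]

/-- `β c = 2·β n` forces `n = 0`: digit by digit (`c % 2 ≡ 2 (n % 2) (mod 3)` forces both bits to vanish). -/
theorem eq_zero_of_ofDigits_three_digits_two_eq_two_mul : ∀ n c : ℕ,
    Nat.ofDigits 3 (Nat.digits 2 c) = Nat.ofDigits 3 (Nat.digits 2 n) + Nat.ofDigits 3 (Nat.digits 2 n) → n = 0 := by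
  intro n
  induction n using Nat.strong_induction_on with
  | _ n ihn =>
    intro c hc
    rw [ofDigits_three_digits_two c, ofDigits_three_digits_two n] at hc
    have hc2 : Nat.ofDigits 3 (Nat.digits 2 (c / 2)) =
        Nat.ofDigits 3 (Nat.digits 2 (n / 2)) + Nat.ofDigits 3 (Nat.digits 2 (n / 2)) := by omega
    rcases Nat.eq_zero_or_pos n with hn | hn
    · exact hn
    · have := ihn (n / 2) (by omega) (c / 2) hc2
      omega

/-- **No non-trivial 3-term progressions among numbers with base-3 digits in `{0,1}`** (Erdős–Turán 1936):
`β a + β c = 2·β b` forces `a = b`. -/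
theorem eq_of_ofDigits_three_digits_two_add : ∀ a b c : ℕ,
    Nat.ofDigits 3 (Nat.digits 2 a) + Nat.ofDigits 3 (Nat.digits 2 c) =
      Nat.ofDigits 3 (Nat.digits 2 b) + Nat.ofDigits 3 (Nat.digits 2 b) → a = b := by
  intro a
  induction a using Nat.strong_induction_on with
  | _ a ih =>
    intro b c h
    rw [ofDigits_three_digits_two a, ofDigits_three_digits_two b, ofDigits_three_digits_two c] at h
    have hdig : a % 2 = b % 2 ∧ c % 2 = b % 2 := by
      rcases Nat.mod_two_eq_zero_or_one a with ha | ha <;> rcases Nat.mod_two_eq_zero_or_one b with hb | hb <;>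
        rcases Nat.mod_two_eq_zero_or_one c with hc | hc <;> rw [ha, hb, hc] at h ⊢ <;> omega
    have hrest : Nat.ofDigits 3 (Nat.digits 2 (a / 2)) + Nat.ofDigits 3 (Nat.digits 2 (c / 2)) =
        Nat.ofDigits 3 (Nat.digits 2 (b / 2)) + Nat.ofDigits 3 (Nat.digits 2 (b / 2)) := by omega
    rcases Nat.eq_zero_or_pos a with ha | ha
    · subst ha
      rw [Nat.zero_div, Nat.digits_zero, Nat.ofDigits_nil, zero_add] at hrest
      have := eq_zero_of_ofDigits_three_digits_two_eq_two_mul (b / 2) (c / 2) hrest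
      omega
    · have := ih (a / 2) (by omega) (b / 2) (c / 2) hrest
      omega

/-- The size bound: `x < 2^t → 2·β x + 1 ≤ 3^t` (all `t` base-3 digits at most `1`). -/
theorem two_mul_ofDigits_three_digits_two_lt : ∀ t x : ℕ, x < 2 ^ t →
    2 * Nat.ofDigits 3 (Nat.digits 2 x) + 1 ≤ 3 ^ t := by
  intro t
  induction t with
  | zero =>
    intro x hx
    have : x = 0 := by omega
    subst this; simp
  | succ t ih =>
    intro x hx
    rw [pow_succ] at hx
    rw [ofDigits_three_digits_two x, pow_succ]
    have := ih (x / 2) (by omega)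
    omega

/-! ## The explicit cyclic law -/

/-- **For all `t`, all `k ≤ 2^t` and all `m ≥ 8·3^t`, the cyclic group `ℤ/mℤ` admits `k` simultaneous-TPP triples of 2-subsets**
(`(2,2,2)^k`): the 3-AP-free cyclic law on `f i = Nat.ofDigits 3 (Nat.digits 2 i)`, `i < k ≤ 2^t`, whose values satisfy
`16 fᵢ + 8 ≤ 8·3^t ≤ m`.  Census reading: `M_k ≤ 8·3^{⌈log₂ k⌉} < 24·k^{log₂ 3}`. [cite: CohnKleinbergSzegedyUmans2005, Def. 5.1] -/
theorem exists_isSTPP_222pow_zmod_of_le_two_pow (t k m : ℕ) (hk : k ≤ 2 ^ t) (hm : 8 * 3 ^ t ≤ m) :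
    ∃ A B C : Fin k → Finset (ZMod m), IsSTPP A B C ∧
      ∀ i, (A i).card = 2 ∧ (B i).card = 2 ∧ (C i).card = 2 := by
  refine exists_isSTPP_222pow_zmod_of_threeAPFree (fun i : Fin k => Nat.ofDigits 3 (Nat.digits 2 (i : ℕ))) ?_ ?_ ?_
  · intro i j h
    exact Fin.ext (eq_of_ofDigits_three_digits_two_add i j i (by simp only at h; omega))
  · rintro _ ⟨a, rfl⟩ _ ⟨b, rfl⟩ _ ⟨c, rfl⟩ h
    obtain rfl : a = b := Fin.ext (eq_of_ofDigits_three_digits_two_add a b c h)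
    rfl
  · intro i
    have := two_mul_ofDigits_three_digits_two_lt t i (lt_of_lt_of_le i.isLt hk)
    change 16 * Nat.ofDigits 3 (Nat.digits 2 (i : ℕ)) + 8 ≤ m
    omega

/-- **A finite abelian group of exponent `≥ 8·3^t` admits `(2,2,2)^k` for every `k ≤ 2^t`** (transport along `ℤ/(ord g) ↪ G`).
[cite: CohnKleinbergSzegedyUmans2005, Def. 5.1] -/
theorem exists_isSTPP_222pow_of_exponent_ge_two_pow {G : Type*} [AddCommGroup G] [Finite G] (t k : ℕ)
    (hk : k ≤ 2 ^ t) (h : 8 * 3 ^ t ≤ AddMonoid.exponent G) :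
    ∃ A B C : Fin k → Finset G, IsSTPP A B C ∧ ∀ i, (A i).card = 2 ∧ (B i).card = 2 ∧ (C i).card = 2 := by
  obtain ⟨g, hg⟩ := AddMonoid.exists_addOrderOf_eq_exponent (AddMonoid.ExponentExists.of_finite (G := G))
  exact exists_isSTPP_222pow_of_injective _ (zmod_lift_zmultiples_injective g)
    (exists_isSTPP_222pow_zmod_of_le_two_pow t k (addOrderOf g) hk (by rw [hg]; exact h))

/-- Worked instance `t = 6`: **`(2,2,2)^64 ⊆ ℤ/mℤ` for every `m ≥ 5832`** (`= 8·3⁶`; the quadratic law needs `m ≥ 32264`; the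
tree's non-cyclic `(2,2,2)^100 ⊆ (ℤ/3)^… × …` instance of `STPPTricoloredProduct.lean` also has order `5832`).
[cite: CohnKleinbergSzegedyUmans2005, Def. 5.1] -/
theorem exists_isSTPP_222pow64_zmod_of_le5832 (m : ℕ) (hm : 5832 ≤ m) :
    ∃ A B C : Fin 64 → Finset (ZMod m), IsSTPP A B C ∧
      ∀ i, (A i).card = 2 ∧ (B i).card = 2 ∧ (C i).card = 2 :=
  exists_isSTPP_222pow_zmod_of_le_two_pow 6 64 m (by norm_num) (by norm_num; omega)

end Summit.MatrixMultiplication.OmegaCensus
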